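import Mathlib
import HarnessLib
import Literature.Analysis.FluidPDE.LocalTypeIMorreyProofs
import Literature.Analysis.FluidPDE.SereginSverakPressureLocalTypeI
import Literature.Analysis.FluidPDE.SpaceTimeRescaling
import Literature.Analysis.FluidPDE.SuitableWeakRescaling
import Literature.Analysis.FluidPDE.CKNInnerCylinders
import Summits.NavierStokesRegularity.NavierStokesRegularity.Theorems.HalfHolderEnergyHolderBridge
import Summits.NavierStokesRegularity.NavierStokesRegularity.Theorems.StretchingWellBindingEnstrophyQuarterLawDissipationQuantum
import Summits.NavierStokesRegularity.NavierStokesRegularity.Theorems.StretchingWellBindingEnstrophyQuarterLawSparsenessTools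
import Summits.NavierStokesRegularity.NavierStokesRegularity.Theorems.StretchingWellBindingEnstrophyQuarterLawSparsenessOverlap

/-!
# Shelf 1574, line `sparse_sieve`: the window quarter law forces UNIFORM SPARSENESS at fine scales
# (the counting half of the no-loss certificate for stub S2 `UniformSparseness`)

Helper file (`--supports stmt-NavierStokesRegularity-1574 --as helper`): the CHARACTERISATION converse of
`Cruxes/EnstrophyQuarterLaw/Lines/sparse_sieve.md` for its HARDEST stub ("`EnergyHalfHolder ⇒ UniformSparseness`
by the dissipation quantum: `N` separated concentrating balls dissipate `≥ ε r` each, the window law pays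
`K r`"), kernel-checked at the scales where the resolution ratio of the quantum is affordable:
`sparse_fine_of_window` — classical solution on `[0, T)`, Leray–Hopf, window law
`∫_a^b ∫ |curl u|² ≤ K √(b − a)` ⟹ `∃ r₁ > 0, ∀ ε₀ > 0, ∃ N₀ ϑ, ∀ t ∈ [T/2, T), ∀ r ≤ ϑ r₁`, every
`4r`-separated family of centres `x` with `∫_{B(x, 2r)} |u(t)|³ ≥ ε₀³` has `≤ N₀` members.

PROOF. Unit-viscosity rescaling with Tao's pressure gauge as in `…EnstrophyQuarterLawLocalTypeI`
(`v(s, y) = ν⁻¹ u(ν⁻¹ s, y)`): on every cylinder `Q_R(τ, x)`, `R ≤ r₁/2`, `r₁² ≤ τ ≤ νT`,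
`A + E + C + D ≤ KS` (`Seregin2020.scaledEnergies_bounded_of_cknE_le_unif`; energy, global `L^{3/2}` budget of
the gauged pressure, window law). Given `ε₀`, the quantum (`DissipationQuantum.small_of_cknE_le`, level `KS`,
target `l(ε₀, ν)`) supplies `η, ϑ`. For a concentrating family `F` at time `t` put `ϱ = r/ϑ`, `ϱ' = ϱ + 2r`,
`τ = min(νT, νt + r²/8)`: the cylinders `Q_{ϱ'}(τ, x)`, `x ∈ F`, overlap `≤ ((1/ϑ + 4)/2)³ =: Mu` times, so
the rescaled window law gives `Σ_x ∫∫_{Q_{ϱ'}(τ,x)} |∇v|² ≤ Mu KE ϱ'`; if `card F > ⌈3 Mu KE/η⌉` some `x₀` has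
`E(ϱ'; (τ, x₀)) ≤ η/3`, hence `E(ϱ; (τ, y)) ≤ η` for all `y ∈ B(x₀, 2r)`; the quantum bounds `|v| ≤ l/r` a.e.
on `Q_{r/2}(τ, y) ∋ (νt, y)`, everywhere by continuity, so `|u(t)| ≤ νl/r` on `B(x₀, 2r)` and
`∫_{B(x₀,2r)} |u(t)|³ ≤ 8 |B₁| ν³ l³ < ε₀³`, contradicting concentration.

NOT HERE (residual of S2 as a no-loss cut, registered order `∃ r₀, ∀ ε₀, ∃ N₀`): COARSE scales
`ϑ(ε₀) r₁ < r ≤ r₀` (near field: volume packing in a fixed ball; far field: exterior `L³` bound from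
`FarFieldEnstrophy` + energy + exterior Sobolev) and EARLY times `t < T/2` (`‖u(t)‖₃³ ≤ U · 2E₀`).

HONEST FRAMING: conditional bookkeeping about ONE hypothetical solution obeying the OPEN window law
(`EnergyHalfHolder` 25161 / `EnstrophyQuarterLaw` 1574); nothing here bears on the regularity problem;
`UniformSparseness` (S2) stays OPEN. No summit statement is proved.
-/

noncomputable section

-- the summit-side namespace repeats a component by design (D-0017)
set_option linter.dupNamespace false

namespace Summit.NavierStokesRegularity.NavierStokesRegularity.Theorems.EnstrophyQuarterLaw.Sparseness

open Set MeasureTheory Function Metric Filter Topology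
open scoped ENNReal NNReal
open Literature.Analysis.FluidPDE

/-! ### The window law forces uniform sparseness at fine scales -/

variable {ν T : ℝ} {u : ℝ → EuclideanSpace ℝ (Fin 3) → EuclideanSpace ℝ (Fin 3)}
  {p : ℝ → EuclideanSpace ℝ (Fin 3) → ℝ}

-- one long assembly (rescaling set-up + counting); the default budget does not suffice
set_option maxHeartbeats 800000 in
/-- **Window quarter law ⇒ uniform sparseness of `L³`-concentration at fine scales.** For a classical
solution on `[0, T)` (`ν > 0`), Leray–Hopf on `[0, T]`, with `∫_a^b ∫ |curl u|² ≤ K √(b − a)`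
(`0 ≤ a ≤ b ≤ T`, `K ≥ 0`): there is `r₁ > 0` such that for every `ε₀ > 0` there are `N₀ ∈ ℕ` and
`ϑ ∈ (0, 1]` such that for all `t ∈ [T/2, T)`, all `0 < r ≤ ϑ r₁` and every finite family `F ⊆ ℝ³` of
`4r`-separated centres with `∫_{B(x, 2r)} |u(t)|³ ≥ ε₀³` for all `x ∈ F`, `card F ≤ N₀`. (Dissipation
quantum + bounded overlap + window law; module docstring.) [folklore] -/
theorem sparse_fine_of_window (hν : 0 < ν) (hT : 0 < T)
    (hsol : IsClassicalNSSolutionOn (Ico 0 T) ν 0 u p) (hLH : IsLerayHopfOn T ν 0 (u 0) u)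
    {K : ℝ} (hK : 0 ≤ K)
    (hwin : ∀ a b : ℝ, 0 ≤ a → a ≤ b → b ≤ T →
      ∫⁻ t in Ioo a b, ∫⁻ x, ‖curl (u t) x‖ₑ ^ 2 ≤ ENNReal.ofReal (K * Real.sqrt (b - a))) :
    ∃ r₁ : ℝ, 0 < r₁ ∧ ∀ ε₀ : ℝ, 0 < ε₀ → ∃ (N₀ : ℕ) (ϑ : ℝ), 0 < ϑ ∧ ϑ ≤ 1 ∧
      ∀ t ∈ Ico (T / 2) T, ∀ r ∈ Ioc 0 (ϑ * r₁), ∀ F : Finset (EuclideanSpace ℝ (Fin 3)),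
        (∀ x ∈ F, ∀ y ∈ F, x ≠ y → 4 * r ≤ dist x y) →
        (∀ x ∈ F, ENNReal.ofReal (ε₀ ^ 3) ≤ ∫⁻ y in ball x (2 * r), ‖u t y‖ₑ ^ 3) →
        F.card ≤ N₀ := by
  -- ### the unit-viscosity rescaling `v = α • stPull α 1 0 0 u`, `α = ν⁻¹` (as in `LocalTypeI`)
  set α : ℝ := ν⁻¹ with hα
  have hαpos : 0 < α := inv_pos.2 hν
  have hαν : α * ν = 1 := by rw [hα, inv_mul_cancel₀ hν.ne']
  have hνα : ν * α = 1 := by rw [mul_comm, hαν]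
  have hβeq : α = α * 1 := (mul_one α).symm
  set Sl : TopologicalSpace.Opens (ℝ × EuclideanSpace ℝ (Fin 3)) :=
    ⟨Ioo 0 T ×ˢ univ, isOpen_Ioo.prod isOpen_univ⟩ with hSldef
  have hSlsub : (Sl : Set (ℝ × EuclideanSpace ℝ (Fin 3))) ⊆ Ioo 0 T ×ˢ univ := Subset.rfl
  set q : ℝ → EuclideanSpace ℝ (Fin 3) → ℝ := fun t x => p t x - (p t 0 - normalisedPressure (u t) 0)
    with hq
  set v : ℝ → EuclideanSpace ℝ (Fin 3) → EuclideanSpace ℝ (Fin 3) := α • stPull α 1 0 0 u with hv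
  set G : ℝ → EuclideanSpace ℝ (Fin 3) → EuclideanSpace ℝ (Fin 3) →L[ℝ] EuclideanSpace ℝ (Fin 3) :=
    (α * 1) • stPull α 1 0 0 fun t x => fderiv ℝ (u t) x with hG
  have hsw : IsSuitableWeakSolutionOn (stPreimage α 1 0 0 Sl) 1 0 v (α ^ 2 • stPull α 1 0 0 q) := by
    have h0 := (SereginSverak2002.isSuitableWeakSolutionOn_gauge_of_classical hν hT hsol hLH Sl
      hSlsub).stRescale hαpos one_pos hβeq 0 0
    have hvisc : α * ν / 1 = 1 := by rw [div_one, hαν]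
    have hforce : ((α ^ 2 * 1) • stPull α 1 0 0 (0 : ℝ → EuclideanSpace ℝ (Fin 3) →
        EuclideanSpace ℝ (Fin 3))) = 0 := by
      funext s y; simp [stPull]
    rw [hvisc, hforce] at h0
    exact h0
  have hGv : HasWeakSpatialGradientOn (stPreimage α 1 0 0 Sl) v G :=
    (hasWeakSpatialGradientOn_of_contDiffOn isOpen_Ioo hSlsub
      ((SereginSverak2002.classical_Ioo hsol).smooth_velocity.of_le (by norm_cast))).stRescale
      α hαpos one_pos 0 0
  have hcyl : ∀ (τ ρ : ℝ) (x : EuclideanSpace ℝ (Fin 3)), ρ ^ 2 ≤ τ → τ ≤ ν * T →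
      parabolicCylinder ρ ((τ, x) : ℝ × EuclideanSpace ℝ (Fin 3)) ⊆
        ((stPreimage α 1 0 0 Sl : TopologicalSpace.Opens (ℝ × EuclideanSpace ℝ (Fin 3))) :
          Set (ℝ × EuclideanSpace ℝ (Fin 3))) := by
    intro τ ρ x hρτ hτT w hw
    rw [mem_parabolicCylinder] at hw
    change stAffine α 1 0 0 w ∈ Ioo 0 T ×ˢ (univ : Set (EuclideanSpace ℝ (Fin 3)))
    rw [mem_prod, stAffine_fst]
    have hw1 : 0 < w.1 := by nlinarith [hw.1.1, sq_nonneg ρ]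
    have hw2 : α * w.1 < α * (ν * T) := mul_lt_mul_of_pos_left (lt_of_lt_of_le hw.1.2 hτT) hαpos
    have e : α * (ν * T) = T := by rw [← mul_assoc, hαν, one_mul]
    refine ⟨⟨by nlinarith [mul_pos hαpos hw1], by linarith⟩, mem_univ _⟩
  set r₁ : ℝ := min 1 (Real.sqrt (ν * T / 2)) with hr₁
  have hr₁pos : 0 < r₁ := lt_min one_pos (Real.sqrt_pos.2 (by positivity))
  have hr₁sq : r₁ ^ 2 ≤ ν * T / 2 := by
    have h1 : r₁ ≤ Real.sqrt (ν * T / 2) := min_le_right _ _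
    have h2 := pow_le_pow_left₀ hr₁pos.le h1 2
    rwa [Real.sq_sqrt (by positivity)] at h2
  have hr₁0 : ENNReal.ofReal r₁ ≠ 0 := (ENNReal.ofReal_pos.2 hr₁pos).ne'
  set E₀ : ℝ := VectorCalculus.kineticEnergy (u 0) with hE₀
  set A₀e : ℝ≥0∞ := (ENNReal.ofReal r₁)⁻¹ * (‖α‖ₑ ^ 2 * ENNReal.ofReal (2 * E₀)) with hA₀e
  have hA₀top : A₀e ≠ ⊤ := ENNReal.mul_ne_top (ENNReal.inv_ne_top.2 hr₁0)
    (ENNReal.mul_ne_top (by simp) ENNReal.ofReal_ne_top)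
  set Pq : ℝ≥0∞ := ‖α ^ 2‖ₑ ^ (3 / 2 : ℝ) *
      ENNReal.ofReal (α * (1 : ℝ) ^ Module.finrank ℝ (EuclideanSpace ℝ (Fin 3)))⁻¹ *
      ∫⁻ z in Ioo 0 T ×ˢ (univ : Set (EuclideanSpace ℝ (Fin 3))), ‖q z.1 z.2‖ₑ ^ (3 / 2 : ℝ) with hPq
  have hPqtop : Pq ≠ ⊤ :=
    ENNReal.mul_ne_top (ENNReal.mul_ne_top (ENNReal.rpow_ne_top_of_nonneg (by norm_num) enorm_ne_top)
      ENNReal.ofReal_ne_top) (SereginSverak2002.lintegral_slab_gauged_pressure_lt_top hν hT hsol hLH).ne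
  set D₀e : ℝ≥0∞ := (ENNReal.ofReal r₁ ^ 2)⁻¹ * Pq with hD₀e
  have hD₀top : D₀e ≠ ⊤ := ENNReal.mul_ne_top (ENNReal.inv_ne_top.2 (pow_ne_zero _ hr₁0)) hPqtop
  set KE : ℝ := α * Real.sqrt α * K with hKE
  have hKE0 : 0 ≤ KE := by positivity
  obtain ⟨KS, hKS⟩ :=
    Seregin2020.scaledEnergies_bounded_of_cknE_le_unif KE.toNNReal A₀e.toNNReal D₀e.toNNReal
  have hcont : ContinuousOn (uncurry u) (Ico 0 T ×ˢ (univ : Set (EuclideanSpace ℝ (Fin 3)))) :=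
    SereginSverak2002.continuousOn_uncurry hsol
  -- ### the rescaled window law on whole-space slabs `(τ - ρ², τ) × ℝ³`
  have hslab : ∀ (τ ρ : ℝ), 0 < ρ → ρ ^ 2 ≤ τ → τ ≤ ν * T →
      ∫⁻ w in Ioo (τ - ρ ^ 2) τ ×ˢ (univ : Set (EuclideanSpace ℝ (Fin 3))),
        ENNReal.ofReal (frobeniusNormSq (G w.1 w.2)) ≤ ENNReal.ofReal (KE * ρ) := by
    intro τ ρ hρ hρτ hτT
    have ha : 0 ≤ α * (τ - ρ ^ 2) := mul_nonneg hαpos.le (sub_nonneg.2 hρτ)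
    have hab : α * (τ - ρ ^ 2) ≤ α * τ := by nlinarith [sq_nonneg ρ]
    have hb : α * τ ≤ T := by
      have h1 : α * τ ≤ α * (ν * T) := mul_le_mul_of_nonneg_left hτT hαpos.le
      rwa [← mul_assoc, hαν, one_mul] at h1
    have hpre : stAffine α 1 0 0 ⁻¹'
        (Ioo (α * (τ - ρ ^ 2)) (α * τ) ×ˢ (univ : Set (EuclideanSpace ℝ (Fin 3)))) =
          Ioo (τ - ρ ^ 2) τ ×ˢ (univ : Set (EuclideanSpace ℝ (Fin 3))) := by
      ext w
      simp only [mem_preimage, mem_prod, stAffine_fst, mem_Ioo, zero_add, mem_univ, and_true]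
      constructor
      · rintro ⟨h1, h2⟩
        exact ⟨by nlinarith, lt_of_mul_lt_mul_left h2 hαpos.le⟩
      · rintro ⟨h1, h2⟩
        exact ⟨by nlinarith, mul_lt_mul_of_pos_left h2 hαpos⟩
    have hwin_cyl := HolderBridge.lintegral_cylinder_frobeniusNormSq_le_of_window hν hsol hLH ha hb
      (hwin _ _ ha hab hb) (univ : Set (EuclideanSpace ℝ (Fin 3)))
    rw [hG, ← hpre, setLIntegral_frobeniusNormSq_stRescale hαpos one_pos 0 0 (α * 1)
      (fun t x => fderiv ℝ (u t) x) _]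
    refine (mul_le_mul' le_rfl hwin_cyl).trans (le_of_eq ?_)
    rw [show α * τ - α * (τ - ρ ^ 2) = α * ρ ^ 2 by ring, Real.sqrt_mul hαpos.le,
      Real.sqrt_sq hρ.le, mul_one, one_pow, mul_one,
      ← ENNReal.ofReal_mul (sq_nonneg _), ← ENNReal.ofReal_mul (by positivity)]
    congr 1
    rw [hKE]
    field_simp
  -- ### the uniform scaled bound `A + E + C + D ≤ KS` on every admissible cylinder
  have hKSz : ∀ (τ : ℝ) (x : EuclideanSpace ℝ (Fin 3)), r₁ ^ 2 ≤ τ → τ ≤ ν * T →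
      ∀ R ∈ Ioc (0 : ℝ) (r₁ / 2),
        cknAEss R ((τ, x) : ℝ × EuclideanSpace ℝ (Fin 3)) v + cknE R (τ, x) G + cknC R (τ, x) v +
          cknD R (τ, x) (α ^ 2 • stPull α 1 0 0 q) ≤ KS := by
    intro τ x hτ₁ hτT R hR
    set z : ℝ × EuclideanSpace ℝ (Fin 3) := (τ, x) with hz
    have hzsub := hcyl τ r₁ x hτ₁ hτT
    have hA : cknAEss r₁ z v ≤ A₀e := by
      unfold cknAEss
      refine essSup_le_of_ae_le _ ?_
      filter_upwards [ae_restrict_mem measurableSet_Ioo] with s hs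
      have hs' : z.1 - r₁ ^ 2 < s ∧ s < z.1 := hs
      have hs0 : 0 < s := by simp only [hz] at hs'; nlinarith [hs'.1]
      have hsT : α * s ∈ Icc 0 T := by
        refine ⟨by positivity, ?_⟩
        have h1 : α * s ≤ α * (ν * T) :=
          mul_le_mul_of_nonneg_left ((show s < τ by simpa [hz] using hs'.2).le.trans hτT) hαpos.le
        rw [← mul_assoc, hαν, one_mul] at h1
        exact h1
      refine mul_le_mul' le_rfl ?_
      calc ∫⁻ y in ball z.2 r₁, ‖v s y‖ₑ ^ 2
          = ∫⁻ y in ball z.2 r₁, ‖α‖ₑ ^ 2 * ‖u (α * s) y‖ₑ ^ 2 := by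
            refine lintegral_congr fun y => ?_
            rw [hv, smul_stPull_apply, enorm_smul, mul_pow, zero_add, zero_add, one_smul]
        _ = ‖α‖ₑ ^ 2 * ∫⁻ y in ball z.2 r₁, ‖u (α * s) y‖ₑ ^ 2 := by
            rw [lintegral_const_mul' _ _ (by simp)]
        _ ≤ ‖α‖ₑ ^ 2 * ∫⁻ y, ‖u (α * s) y‖ₑ ^ 2 := mul_le_mul' le_rfl (setLIntegral_le_lintegral _ _)
        _ ≤ ‖α‖ₑ ^ 2 * ENNReal.ofReal (2 * E₀) :=
            mul_le_mul' le_rfl (hLH.lintegral_enorm_sq_le hν.le hsT)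
    have hD : cknD r₁ z (α ^ 2 • stPull α 1 0 0 q) ≤ D₀e := by
      unfold cknD
      refine mul_le_mul' le_rfl ?_
      calc ∫⁻ w in parabolicCylinder r₁ z, ‖(α ^ 2 • stPull α 1 0 0 q) w.1 w.2‖ₑ ^ (3 / 2 : ℝ)
          ≤ ∫⁻ w in stAffine α 1 0 0 ⁻¹' (Ioo 0 T ×ˢ (univ : Set (EuclideanSpace ℝ (Fin 3)))),
              ‖(α ^ 2 • stPull α 1 0 0 q) w.1 w.2‖ₑ ^ (3 / 2 : ℝ) :=
            lintegral_mono_set hzsub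
        _ = Pq := by
            rw [hPq, setLIntegral_enorm_rpow_stRescale hαpos one_pos 0 0 (α ^ 2) q _ (by norm_num)]
    have hE : ∀ r ∈ Ioc (0 : ℝ) r₁, cknE r z G ≤ ENNReal.ofReal KE := by
      intro r hr
      refine HolderBridge.cknE_le_of_lintegral_le z hr.1 ?_
      have hr2τ : r ^ 2 ≤ τ := (pow_le_pow_left₀ hr.1.le hr.2 2).trans hτ₁
      calc ∫⁻ w in parabolicCylinder r z, ENNReal.ofReal (frobeniusNormSq (G w.1 w.2))
          ≤ ∫⁻ w in Ioo (τ - r ^ 2) τ ×ˢ (univ : Set (EuclideanSpace ℝ (Fin 3))),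
              ENNReal.ofReal (frobeniusNormSq (G w.1 w.2)) :=
            lintegral_mono_set (prod_mono Subset.rfl (subset_univ _))
        _ ≤ ENNReal.ofReal (KE * r) := hslab τ r hr.1 hr2τ hτT
    have hS := hKS _ _ _ _ hsw hGv z r₁ hr₁pos hzsub
      (hA.trans (ENNReal.coe_toNNReal hA₀top).symm.le) (hD.trans (ENNReal.coe_toNNReal hD₀top).symm.le)
      (fun r hr => (hE r hr).trans (le_of_eq rfl)) R hR
    exact hS
  refine ⟨r₁ / 6, by positivity, fun ε₀ hε₀ => ?_⟩
  set V : ℝ := (volume (ball (0 : EuclideanSpace ℝ (Fin 3)) 1)).toReal with hV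
  have hV0 : 0 ≤ V := ENNReal.toReal_nonneg
  have hVtop : volume (ball (0 : EuclideanSpace ℝ (Fin 3)) 1) ≠ ⊤ := measure_ball_lt_top.ne
  obtain ⟨l, hlpos, hsmallV⟩ := SparsenessOverlap.exists_level (V := V) hν hV0 hε₀
  obtain ⟨η, ϑ, hη, hϑ, hϑ1, Hq⟩ := DissipationQuantum.small_of_cknE_le KS hlpos
  set Mu : ℝ := ((1 / ϑ + 4) / 2) ^ 3 with hMu
  have hMu0 : 0 ≤ Mu := by positivity
  set N₀ : ℕ := ⌈3 * Mu * KE / η⌉₊ with hN₀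
  refine ⟨N₀, ϑ, hϑ, hϑ1, fun t ht r hr F hsep hconc => ?_⟩
  by_contra hN
  rw [not_le] at hN
  have hFne : F.Nonempty := Finset.card_pos.1 (lt_of_le_of_lt (Nat.zero_le _) hN)
  have hNreal : 3 * Mu * KE / η < (F.card : ℝ) := (Nat.le_ceil _).trans_lt (by exact_mod_cast hN)
  have hr0 : 0 < r := hr.1
  have hrr₁ : r ≤ ϑ * (r₁ / 6) := hr.2
  set ϱ : ℝ := r / ϑ with hϱ
  have hϱpos : 0 < ϱ := div_pos hr0 hϑ
  have hϑϱ : ϑ * ϱ = r := by rw [hϱ]; field_simp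
  have hrϱ : r ≤ ϱ := by
    rw [← hϑϱ]; exact mul_le_of_le_one_left hϱpos.le hϑ1
  have hϱr₁ : ϱ ≤ r₁ / 6 := by
    rw [hϱ, div_le_iff₀ hϑ]; linarith
  set ϱ' : ℝ := ϱ + 2 * r with hϱ'
  have hϱ'pos : 0 < ϱ' := by positivity
  have hϱϱ' : ϱ ≤ ϱ' := by rw [hϱ']; linarith
  have hϱ'r₁ : ϱ' ≤ r₁ / 2 := by
    have : r ≤ r₁ / 6 := hrϱ.trans hϱr₁
    rw [hϱ']; linarith
  have hratio : ϱ' / ϱ ≤ 3 := by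
    rw [div_le_iff₀ hϱpos, hϱ']; linarith
  set σ₀ : ℝ := ν * t with hσ₀
  set τ : ℝ := min (ν * T) (σ₀ + r ^ 2 / 8) with hτ
  have hτT : τ ≤ ν * T := min_le_left _ _
  have hνt : ν * (T / 2) ≤ σ₀ := mul_le_mul_of_nonneg_left ht.1 hν.le
  have hνT2 : ν * (T / 2) = ν * T / 2 := by ring
  have hr₁σ₀ : r₁ ^ 2 ≤ σ₀ := by linarith [hr₁sq, hνt, hνT2]
  have hνTpos : 0 < ν * T := mul_pos hν hT
  have hr2pos : 0 < r ^ 2 := pow_pos hr0 2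
  have hτ₁ : r₁ ^ 2 ≤ τ := le_min (by linarith [hr₁sq, hνTpos]) (by linarith [hr₁σ₀, hr2pos])
  have hσ₀τ : σ₀ < τ := lt_min (mul_lt_mul_of_pos_left ht.2 hν) (by linarith [hr2pos])
  have hτσ₀ : τ - (ϑ * ϱ / 2) ^ 2 < σ₀ := by
    rw [show ϑ * ϱ / 2 = r / 2 by rw [← hϑϱ]]
    have h1 : τ ≤ σ₀ + r ^ 2 / 8 := min_le_right _ _
    have h2 : (r / 2) ^ 2 = r ^ 2 / 4 := by ring
    rw [h2]
    linarith [hr2pos]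
  have hϱ'τ : ϱ' ^ 2 ≤ τ := by
    have h1 : ϱ' ≤ r₁ := by linarith [hϱ'r₁, hr₁pos]
    exact (pow_le_pow_left₀ hϱ'pos.le h1 2).trans hτ₁
  -- ### pigeonhole: a centre `x₀ ∈ F` whose cylinder `Q_{ϱ'}(τ, x₀)` dissipates little
  have hsum : ∑ x ∈ F, ∫⁻ w in parabolicCylinder ϱ' ((τ, x) : ℝ × EuclideanSpace ℝ (Fin 3)),
      ENNReal.ofReal (frobeniusNormSq (G w.1 w.2)) ≤ ENNReal.ofReal (Mu * (KE * ϱ')) := by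
    have h4r : 0 < 4 * r := by positivity
    have key := SparsenessOverlap.sum_setLIntegral_prod_ball_le_of_separated h4r hϱ'pos F hsep
      (measurableSet_Ioo (a := τ - ϱ' ^ 2) (b := τ))
      (fun w => ENNReal.ofReal (frobeniusNormSq (G w.1 w.2)))
    have e : ((ϱ' + 4 * r / 2) / (4 * r / 2)) ^ 3 = Mu := by
      rw [hMu, hϱ', hϱ]
      congr 1
      field_simp
      ring
    rw [e] at key
    refine key.trans ?_
    rw [ENNReal.ofReal_mul hMu0]
    exact mul_le_mul' le_rfl (hslab τ ϱ' hϱ'pos hϱ'τ hτT)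
  obtain ⟨x₀, hx₀F, hx₀⟩ : ∃ x₀ ∈ F, ∫⁻ w in parabolicCylinder ϱ' ((τ, x₀) : ℝ × EuclideanSpace ℝ (Fin 3)),
      ENNReal.ofReal (frobeniusNormSq (G w.1 w.2)) ≤ ENNReal.ofReal (η / 3 * ϱ') := by
    refine ENNReal.exists_le_of_sum_le hFne (hsum.trans ?_)
    rw [Finset.sum_const, nsmul_eq_mul, ← ENNReal.ofReal_natCast,
      ← ENNReal.ofReal_mul (Nat.cast_nonneg _)]
    refine ENNReal.ofReal_le_ofReal ?_
    have h0 : 3 * Mu * KE < (F.card : ℝ) * η := (div_lt_iff₀ hη).1 hNreal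
    have h1 : Mu * KE ≤ (F.card : ℝ) * (η / 3) := by linarith
    calc Mu * (KE * ϱ') = (Mu * KE) * ϱ' := by ring
      _ ≤ ((F.card : ℝ) * (η / 3)) * ϱ' := mul_le_mul_of_nonneg_right h1 hϱ'pos.le
      _ = (F.card : ℝ) * (η / 3 * ϱ') := by ring
  have hEx₀ : cknE ϱ' ((τ, x₀) : ℝ × EuclideanSpace ℝ (Fin 3)) G ≤ ENNReal.ofReal (η / 3) :=
    HolderBridge.cknE_le_of_lintegral_le _ hϱ'pos hx₀
  -- ### every point of `B(x₀, 2r)` at the slice: small dissipation above it, hence `|u(t)| ≤ ν l / r`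
  have hpt : ∀ y ∈ ball x₀ (2 * r), ‖u t y‖ ≤ ν * l / r := by
    intro y hy
    set zy : ℝ × EuclideanSpace ℝ (Fin 3) := (τ, y) with hzy
    have hsubc : parabolicCylinder ϱ zy ⊆ parabolicCylinder ϱ' ((τ, x₀) : ℝ × EuclideanSpace ℝ (Fin 3)) := by
      intro w hw
      rw [mem_parabolicCylinder] at hw ⊢
      have hsq : ϱ ^ 2 ≤ ϱ' ^ 2 := pow_le_pow_left₀ hϱpos.le hϱϱ' 2
      refine ⟨⟨by simp only [hzy] at hw ⊢; linarith [hw.1.1], by simpa [hzy] using hw.1.2⟩, ?_⟩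
      have hyx : dist y x₀ < 2 * r := mem_ball.1 hy
      calc dist w.2 x₀ ≤ dist w.2 y + dist y x₀ := dist_triangle _ _ _
        _ < ϱ + 2 * r := add_lt_add hw.2 hyx
    have hEy : cknE ϱ zy G ≤ ENNReal.ofReal η := by
      refine (cknE_le_mul_of_subset hϱ'pos hϱpos hsubc G).trans ?_
      refine (mul_le_mul' le_rfl hEx₀).trans ?_
      rw [← ENNReal.ofReal_mul (by positivity)]
      refine ENNReal.ofReal_le_ofReal ?_
      calc ϱ' / ϱ * (η / 3) ≤ 3 * (η / 3) := mul_le_mul_of_nonneg_right hratio (by positivity)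
        _ = η := by ring
    have hϱ2τ : ϱ ^ 2 ≤ τ := (pow_le_pow_left₀ hϱpos.le hϱϱ' 2).trans hϱ'τ
    have hzysub := hcyl τ ϱ y hϱ2τ hτT
    have hϱhalf : ϱ ∈ Ioc (0 : ℝ) (r₁ / 2) := ⟨hϱpos, by linarith [hϱr₁, hr₁pos]⟩
    have hAy : cknAEss ϱ zy v ≤ KS :=
      le_trans (le_trans (le_trans le_self_add le_self_add) le_self_add) (hKSz τ y hτ₁ hτT ϱ hϱhalf)
    have hDy : ∀ r' ∈ Ioc (0 : ℝ) ϱ, cknD r' zy (α ^ 2 • stPull α 1 0 0 q) ≤ KS := fun r' hr' =>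
      le_trans le_add_self (hKSz τ y hτ₁ hτT r' ⟨hr'.1, hr'.2.trans hϱhalf.2⟩)
    have hbd := Hq _ v _ G hsw hGv zy ϱ hϱpos hzysub hAy hDy hEy
    have hsmall_sub : parabolicCylinder (ϑ * ϱ / 2) zy ⊆ parabolicCylinder ϱ zy :=
      parabolicCylinder_mono (by positivity) (by rw [hϑϱ]; linarith [hrϱ]) zy
    have hvc : ContinuousOn (fun w : ℝ × EuclideanSpace ℝ (Fin 3) => ‖v w.1 w.2‖)
        (parabolicCylinder (ϑ * ϱ / 2) zy) := by
      have hg : Continuous (fun w : ℝ × EuclideanSpace ℝ (Fin 3) => ((α * w.1, w.2) :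
          ℝ × EuclideanSpace ℝ (Fin 3))) := by fun_prop
      have h1 : ContinuousOn (fun w : ℝ × EuclideanSpace ℝ (Fin 3) => u (α * w.1) w.2)
          (parabolicCylinder (ϑ * ϱ / 2) zy) := by
        refine hcont.comp hg.continuousOn fun w hw => ?_
        have hw' := hzysub (hsmall_sub hw)
        change stAffine α 1 0 0 w ∈ Ioo 0 T ×ˢ (univ : Set (EuclideanSpace ℝ (Fin 3))) at hw'
        rw [mem_prod, stAffine_fst, zero_add] at hw'
        exact ⟨Ioo_subset_Ico_self hw'.1, mem_univ _⟩
      have h3 : ContinuousOn (fun w : ℝ × EuclideanSpace ℝ (Fin 3) => v w.1 w.2)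
          (parabolicCylinder (ϑ * ϱ / 2) zy) := by
        refine (h1.const_smul α).congr fun w _ => ?_
        show v w.1 w.2 = α • u (α * w.1) w.2
        rw [hv, smul_stPull_apply, zero_add, zero_add, one_smul]
      exact h3.norm
    have hall := SparsenessTools.le_of_ae_le_of_continuousOn (μ := volume)
      (isOpen_parabolicCylinder (ϑ * ϱ / 2) zy) hvc hbd
    have hmem : ((σ₀, y) : ℝ × EuclideanSpace ℝ (Fin 3)) ∈ parabolicCylinder (ϑ * ϱ / 2) zy := by
      rw [mem_parabolicCylinder]
      refine ⟨⟨?_, ?_⟩, ?_⟩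
      · show τ - (ϑ * ϱ / 2) ^ 2 < σ₀
        exact hτσ₀
      · show σ₀ < τ
        exact hσ₀τ
      · show dist y y < ϑ * ϱ / 2
        rw [dist_self]
        positivity
    have hvpt := hall _ hmem
    have hvσ : v σ₀ y = α • u t y := by
      rw [hv, smul_stPull_apply, zero_add, zero_add, one_smul, hσ₀, ← mul_assoc, hαν, one_mul]
    have hnorm : ‖v σ₀ y‖ = α * ‖u t y‖ := by
      rw [hvσ, norm_smul, Real.norm_of_nonneg hαpos.le]
    have h1 : α * ‖u t y‖ ≤ l / (ϑ * ϱ) := by rw [← hnorm]; exact hvpt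
    rw [hϑϱ] at h1
    have h2 : ν * (α * ‖u t y‖) ≤ ν * (l / r) := mul_le_mul_of_nonneg_left h1 hν.le
    rw [← mul_assoc, hνα, one_mul] at h2
    rw [mul_div_assoc]
    exact h2
  -- ### the `L³` mass of `u(t)` on `B(x₀, 2r)` is then `< ε₀³`: contradiction
  have hfin : Module.finrank ℝ (EuclideanSpace ℝ (Fin 3)) = 3 := by simp
  have hvolball : volume (ball x₀ (2 * r)) =
      ENNReal.ofReal ((2 * r) ^ 3) * volume (ball (0 : EuclideanSpace ℝ (Fin 3)) 1) := by
    rw [Measure.addHaar_ball_of_pos volume x₀ (by positivity : (0 : ℝ) < 2 * r), hfin]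
  have hI : ∫⁻ y in ball x₀ (2 * r), ‖u t y‖ₑ ^ 3 ≤ ENNReal.ofReal (8 * ν ^ 3 * l ^ 3 * V) := by
    have hb : 0 ≤ ν * l / r := by positivity
    calc ∫⁻ y in ball x₀ (2 * r), ‖u t y‖ₑ ^ 3
        ≤ ∫⁻ y in ball x₀ (2 * r), ENNReal.ofReal ((ν * l / r) ^ 3) := by
          refine setLIntegral_mono_ae' measurableSet_ball (ae_of_all _ fun y hy => ?_)
          rw [← ofReal_norm, ← ENNReal.ofReal_pow (norm_nonneg _)]
          exact ENNReal.ofReal_le_ofReal (pow_le_pow_left₀ (norm_nonneg _) (hpt y hy) 3)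
      _ = ENNReal.ofReal ((ν * l / r) ^ 3) * volume (ball x₀ (2 * r)) := setLIntegral_const _ _
      _ = ENNReal.ofReal (8 * ν ^ 3 * l ^ 3 * V) := by
          rw [hvolball, hV, ← mul_assoc, ← ENNReal.ofReal_mul (by positivity),
            ← ENNReal.ofReal_toReal hVtop, ← ENNReal.ofReal_mul (by positivity), ENNReal.toReal_ofReal hV0]
          congr 1
          field_simp
          ring
  have hlt : ∫⁻ y in ball x₀ (2 * r), ‖u t y‖ₑ ^ 3 < ENNReal.ofReal (ε₀ ^ 3) :=
    lt_of_le_of_lt hI ((ENNReal.ofReal_lt_ofReal_iff (pow_pos hε₀ 3)).2 hsmallV)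
  exact absurd (hconc x₀ hx₀F) (not_le.2 hlt)

end Summit.NavierStokesRegularity.NavierStokesRegularity.Theorems.EnstrophyQuarterLaw.Sparseness

end
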